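/-
Copyright (c) 2026 the pub-hodgecm-mathlib formalisation cell (harness21).  Prover seat hodgecm-mathlib-LH4-p09 (g3), req620 Track A «(D-RAM) FOUR-FRAME» squad
(unit U3_Laws, (R-18) «K-ABS-R := NI2 ⊕ KMS», κ-STAGE B brick κB-G «GLUED-STRATA κ-SOCKETS» dealt by LH4-plan (g11) WORD #32 (3); plan LH4-p05 (g3)
`F0/P3c/LH4/LH4-p05/g3/PLAN-KMS-modKappaStageB.v1.LH4p05g3.md` §4; letter `F0/P3c/LH4/LH4-p09/g3/LETTER-kappaBG-RHS.v1.LH4p09g3.md`).  FILE κG-A1.  2026-09-04.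
-/
import Summits.HodgeConjecture.HodgeConjecture.Theorems.F0P3cDyRamDiagonalKappaCountEval        -- ★ Fκ2 (LH4-p05 (g3)): `chiVec_mul_norm`, `chiVec_eq`; brings ★ Fκ1 `KappaCountDefs` p856497 (`kappaCount`, `cosetKappa`, `polarisationCosets`), ★ (O2b) PART 2 `OrbitFibreTransport`
import Summits.HodgeConjecture.HodgeConjecture.Theorems.F0P3cDyRamDiagonalGluedTubeCriterion     -- ★ B5 (i) p855737 (LH4-p10 (g2)): `formCongr_hnf_diagonal`, `det_coe_hnf`, `det_formCongr_diagonal`, `isIntMatrix_of_fin_three`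
import Summits.HodgeConjecture.HodgeConjecture.Theorems.F0P3cDyRamDiagonalStratumTools         -- ★ (LH4-p13 (g2)): `fixedUnitStabilizer_mapGL_diagGLUnits`
import Literature.NumberTheory.Automorphic.UnitaryThreeFourFrameFamilyExists                     -- ★ (B-p04): `normSign_of_isNorm`, `normSign_inv_of_map_eq`, `normSign_mul_of_dichotomy`
import HarnessLib

/-!
# Crux `H413`, line LH4 «(D-RAM) FOUR-FRAME» road — unit U3_Laws (iii), κ-STAGE B brick κB-G, FILE κG-A1 «THE GLUED CLASS: FORM, ORBIT CONSTANCY, χ»: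
# the explicit polarisation of the glued representative `latt V(1, 1, g)`, `kappaCount` is constant on `(K^×)³`-orbits, and `χ_i` of the polarisation

Cell `hodgecm-mathlib` (D-0151), FLOOR 0, crux item H413 = `stmt-HodgeConjecture-24833`, route of record `HCCMUnconditional`; squad F0∕P3c∕LH4 (req618∕req620).  THEOREMS ONLY
(no `def`, no instance, no notation, no `sorry`, default heartbeats); lane `--supports stmt-HodgeConjecture-24833 --as helper` (count-neutral).  LAW-FREE.

THE OBJECT (LH4-p10 (g2) MEMO v2 §4; ★ B5 (i)–(iv)).  In the (S-fin) count of the four-frame census the GLUED stratum `G₁(2ρ, 2t)` of axis `(2ρ, 2ρ+2t, 2ρ+2t)` consists of the lattices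
`latt V(x, ζ, y″)`, `V = (1 0 0; x ϖ^ρ 0; xζ+y″ ϖ^ρζ ϖ^{2ρ+2t})`, `|x| = |ζ| = 1`, `|y″| = |ϖ|^{2t}`; the dualisable ones are the unit-torus orbits `𝒯·latt V(1, 1, g)` of the
representatives with `κ = y″∕(xζ) = g` a `σ`-FIXED element of valuation `|ϖ|^{2t}` (★ (iv-a) `…GluedTorusOrbits`, (iv-c) `…GluedClassRepresentatives`).  The κ-twisted census (KMS road,
LH4-p05 (g3) PLAN v1) weights each lattice by the SIGNED κ-COUNT `kappaCount σ ϖ 0 i M` (★ Fκ1 p856497) which, on a normalised lattice with a type-0 polarisation `D₁`, is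
`[χ_i ≡ 1 on S_F(M)] · χ_i(D₁)` (Fκ2 `kappaCount_zero_eq_of_dichotomy`; `χ_i(D) = Π_{j ≠ i} ω(D_j)`, `ω = normSign σ`).  THIS FILE evaluates it on the glued classes:
* §1 `isVertexLattice_zero_latt_glued_rep` — the EXPLICIT type-0 polarisation of `latt V(1,1,g)`: `D(g) = π₀^{−(ρ+t)}·(g, 1, −1∕(1+g))`, `π₀ = ϖσϖ` (★ B5 (i)'s form at
  `x = ζ = 1`, `y″ = f = g`; Gram `[[0,0,u],[0,u′,·],[u″,·,·]]`, unimodular).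
* §2 `kappaCount_mapGL_diagGLUnits` — `kappaCount σ ϖ tv i` is CONSTANT on `(K^×)³`-orbits (any `tv`): `S_F(z·M) = S_F(M)` (★ `fixedUnitStabilizer_mapGL_diagGLUnits`), the polarisation
  cosets of `z·M` are the translates by `N(z)⁻¹` of those of `M` (★ `isVertexLattice_diagonal_mapGL_diagGLUnits_iff`), and `χ_i` does not see norm factors (Fκ2 `chiVec_mul_norm`).
* §3 `chiVec` of `D(g)`: `χ_0 = ω(−1)·ω(1+g)`, `χ_1 = ω(−1)·ω(g)·ω(1+g)`, `χ_2 = ω(g)` (`ω(π₀^k) = 1`, `ω(x⁻¹) = ω(x)`, multiplicativity under NI2).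
The ALIVE windows, the killers and the head `kappaCount_zero_latt_glued_rep` are FILE κG-A2 `F0P3cDyRamDiagonalKappaGluedClass`.
HONEST LABEL.  Count-neutral (`--supports`); nothing printed is asserted; (KMS)∕(KSS) stay PROVER TARGETS (empirical census laws in diagonal-model currency); `HC_CM` is proved only
modulo the 7 printed citations (2 remaining named inputs: hLiu418 = `stmt-HodgeConjecture-24832`, h413 = `stmt-HodgeConjecture-24833`) until rung 0 closes.

## References
* [Kottwitz1986BaseChangeUnits] R. E. Kottwitz, *Base change for unit elements of Hecke algebras*, Compositio Math. 60 (1986), §1 pp. 240–241 (κ-orbital integrals of units as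
  signed lattice counts modulo the torus).
* [LanglandsShelstad1987] R. P. Langlands, D. Shelstad, *On the definition of transfer factors*, Math. Ann. 278 (1987), §3 (κ as a character of `H¹(F, T)`).
* [Serre1979] J.-P. Serre, *Local Fields*, GTM 67 (1979), Ch. V §3 Prop. 5, Cor. 3 (the unit norm index and the conductor of a ramified quadratic extension).
* [Jacobowitz1962] R. Jacobowitz, *Hermitian forms over local fields*, Amer. J. Math. 84 (1962), §7 (Gram matrices of unimodular lattices).
-/

set_option autoImplicit false

noncomputable section

namespace Summit.HodgeConjecture.HodgeConjecture.Cruxes.H413.F0P3cDyRamDiagonalKappaGluedClassForm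

open Matrix
open Literature.NumberTheory.Automorphic Literature.NumberTheory.Automorphic.HermitianLattice Literature.NumberTheory.Automorphic.UnitaryGroup
open Literature.NumberTheory.Automorphic.UnitaryLatticeTree Literature.NumberTheory.Automorphic.UnitaryThreeFourFrame
open Summit.HodgeConjecture.HodgeConjecture.Cruxes.H413.F0P3cDyRamDiagonalTorusDefs
open Summit.HodgeConjecture.HodgeConjecture.Cruxes.H413.F0P3cDyRamDiagonalStrataDefs
open Summit.HodgeConjecture.HodgeConjecture.Cruxes.H413.F0P3cDyRamDiagonalKappaCountDefs
open Summit.HodgeConjecture.HodgeConjecture.Cruxes.H413.F0P3cDyRamDiagonalKappaCountEval hiding normSign_mul_of_dichotomy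
open Summit.HodgeConjecture.HodgeConjecture.Cruxes.H413.F0P3cDyRamFixedCountDiagonalModel (normSign_mul_norm)
open Summit.HodgeConjecture.HodgeConjecture.Cruxes.H413.F0P3cDyRamStableSumSignClasses (normSign_eq_one_or)
open Summit.HodgeConjecture.HodgeConjecture.Cruxes.H413.F0P3cDyRamDiagonalOrbitFibreTransport (isVertexLattice_diagonal_mapGL_diagGLUnits_iff)
open Summit.HodgeConjecture.HodgeConjecture.Cruxes.H413.F0P3cDyRamDiagonalGluedTubeCriterion (formCongr_hnf_diagonal det_coe_hnf det_formCongr_diagonal isIntMatrix_of_fin_three)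
open Summit.HodgeConjecture.HodgeConjecture.Cruxes.H413.F0P3cDyRamDiagonalStratumTools (fixedUnitStabilizer_mapGL_diagGLUnits)
open scoped Valued WithZero Matrix MatrixGroups

variable {K : Type} [Field K] [Valued K ℤᵐ⁰]

/-! ## §1  The explicit type-0 polarisation of the glued representative `latt V(1, 1, g)` -/

/-- **THE REPRESENTATIVE `latt V(1,1,g)` IS SELF-DUAL FOR `diag(D(g))`, `D(g) = π₀^{−(ρ+t)}·(g, 1, −(1+g)⁻¹)`** (`σ` an isometric involution, `ϖ ≠ 0`, `|ϖ| < 1`, `g = σg`,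
`|g| = |ϖ|^{2t}`, `ρ, t` arbitrary): the Gram matrix on the glued frame is `[[0, 0, −D₁ϖ^c], [0, π₀^ρD₁g∕(1+g), ·], [−σ(ϖ^c)D₁, ·, ·]]` (`c = 2ρ+2t`, `D₁ = π₀^{−(ρ+t)}`), integral with unit
determinant — ★ B5 (i) `isDualisableLattice_latt_hnf_glued_of`'s form at `x = ζ = 1`, `y″ = f = g`, made explicit. [cite: Jacobowitz1962, §7] [cite: Kottwitz1986BaseChangeUnits, §1 pp. 240–241] -/
theorem isVertexLattice_zero_latt_glued_rep {σ : K →+* K} (hσ : ∀ a, σ (σ a) = a) (hvσ : ∀ a, Valued.v (σ a) = Valued.v a)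
    {ϖ : K} (hϖ0 : ϖ ≠ 0) (hϖ1 : Valued.v ϖ < 1) (ρ t : ℕ) {g : K} (hσg : σ g = g) (hg : Valued.v g = Valued.v ϖ ^ (2 * t)) (ht : 1 ≤ t)
    (V : GL (Fin 3) K) (hV : (V : Matrix (Fin 3) (Fin 3) K) = !![1, 0, 0; 1, ϖ ^ ρ, 0; 1 * 1 + g, ϖ ^ ρ * 1, ϖ ^ (2 * ρ + 2 * t)]) :
    IsVertexLattice σ ϖ (Matrix.diagonal ![((ϖ * σ ϖ) ^ (ρ + t))⁻¹ * g, ((ϖ * σ ϖ) ^ (ρ + t))⁻¹, -(((ϖ * σ ϖ) ^ (ρ + t))⁻¹ * (1 + g)⁻¹)]) 0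
      (latt (V : Matrix (Fin 3) (Fin 3) K)) := by
  set c : ℕ := 2 * ρ + 2 * t with hc
  have hvϖ : 0 < Valued.v ϖ := (Valuation.pos_iff _).2 hϖ0
  have hϖ1' : Valued.v ϖ ≤ 1 := hϖ1.le
  have hvϖc : Valued.v ϖ ^ c ≠ 0 := pow_ne_zero _ hvϖ.ne'
  have hpowle : ∀ n : ℕ, Valued.v ϖ ^ n ≤ 1 := fun n => pow_le_one₀ zero_le hϖ1'
  -- `g`, `1 + g`
  have hgv : Valued.v g < 1 := by rw [hg]; exact pow_lt_one₀ zero_le hϖ1 (by omega)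
  have h1g : Valued.v (1 + g) = 1 := Valued.v.map_one_add_of_lt hgv
  have h1g0 : 1 + g ≠ 0 := fun h => by rw [h, map_zero] at h1g; exact zero_ne_one h1g
  have hσ1g : σ (1 + g) = 1 + g := by rw [map_add, map_one, hσg]
  -- `π₀`, `D₁`
  set π₀ : K := ϖ * σ ϖ with hπ₀
  have hσπ₀ : σ π₀ = π₀ := by rw [hπ₀, map_mul, hσ, mul_comm]
  have hvπ₀ : Valued.v π₀ = Valued.v ϖ ^ 2 := by rw [hπ₀, map_mul, hvσ, sq]
  have hσϖ0 : σ ϖ ≠ 0 := fun h => hϖ0 (by rw [← hσ ϖ, h, map_zero])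
  have hπ₀0 : π₀ ≠ 0 := mul_ne_zero hϖ0 hσϖ0
  set D₁ : K := (π₀ ^ (ρ + t))⁻¹ with hD₁
  have hvD₁ : Valued.v D₁ = (Valued.v ϖ ^ c)⁻¹ := by
    rw [hD₁, map_inv₀, map_pow, hvπ₀, ← pow_mul, hc]; congr 2; ring
  have hD₁0 : D₁ ≠ 0 := by rw [hD₁]; exact inv_ne_zero (pow_ne_zero _ hπ₀0)
  have hσD₁ : σ D₁ = D₁ := by rw [hD₁, map_inv₀, map_pow, hσπ₀]
  -- the form
  set D₀ : K := D₁ * g with hD₀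
  set D₂ : K := -(D₁ * (1 + g)⁻¹) with hD₂
  have hvD₂ : Valued.v D₂ = (Valued.v ϖ ^ c)⁻¹ := by
    rw [hD₂, Valuation.map_neg, map_mul, hvD₁, map_inv₀, h1g, inv_one, mul_one]
  have hvD₀ : Valued.v D₀ = (Valued.v ϖ ^ c)⁻¹ * Valued.v ϖ ^ (2 * t) := by rw [hD₀, map_mul, hvD₁, hg]
  let D : Fin 3 → K := ![D₀, D₁, D₂]
  have hD0 : D 0 = D₀ := rfl
  have hD1 : D 1 = D₁ := rfl
  have hD2 : D 2 = D₂ := rfl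
  show IsVertexLattice σ ϖ (Matrix.diagonal D) 0 (latt (V : Matrix (Fin 3) (Fin 3) K))
  -- the Gram matrix
  have hG := formCongr_hnf_diagonal σ D 1 (1 * 1 + g) (ϖ ^ ρ * 1) (ϖ ^ ρ) (ϖ ^ c) V (by rw [hV])
  rw [hD0, hD1, hD2] at hG
  have hvϖρ : Valued.v (ϖ ^ ρ) = Valued.v ϖ ^ ρ := map_pow _ _ _
  have hvσϖρ : Valued.v (σ (ϖ ^ ρ)) = Valued.v ϖ ^ ρ := by rw [hvσ, map_pow]
  have hvϖcK : Valued.v (ϖ ^ c) = Valued.v ϖ ^ c := map_pow _ _ _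
  have hvσϖcK : Valued.v (σ (ϖ ^ c)) = Valued.v ϖ ^ c := by rw [hvσ, map_pow]
  -- the three vanishing entries
  have hG00 : D₀ + σ 1 * D₁ * 1 + σ (1 * 1 + g) * D₂ * (1 * 1 + g) = 0 := by
    rw [map_one, one_mul, map_add, map_mul, map_one, hσg, hD₀, hD₂]; field_simp; ring
  have hG01 : σ 1 * D₁ * ϖ ^ ρ + σ (1 * 1 + g) * D₂ * (ϖ ^ ρ * 1) = 0 := by
    rw [map_one, one_mul, map_add, map_mul, map_one, hσg, hD₂]; field_simp; ring
  have hG10 : σ (ϖ ^ ρ) * D₁ * 1 + σ (ϖ ^ ρ * 1) * D₂ * (1 * 1 + g) = 0 := by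
    rw [mul_one (ϖ ^ ρ), hD₂]; field_simp; ring
  -- the two unit entries and the rest
  have hG02 : Valued.v (σ (1 * 1 + g) * D₂ * ϖ ^ c) = 1 := by
    rw [one_mul, map_mul, map_mul, hσ1g, h1g, one_mul, hvD₂, hvϖcK, inv_mul_cancel₀ hvϖc]
  have hG20 : Valued.v (σ (ϖ ^ c) * D₂ * (1 * 1 + g)) = 1 := by
    rw [one_mul, map_mul, map_mul, hvσϖcK, hvD₂, h1g, mul_inv_cancel₀ hvϖc, one_mul]
  have hG11 : Valued.v (σ (ϖ ^ ρ) * D₁ * ϖ ^ ρ + σ (ϖ ^ ρ * 1) * D₂ * (ϖ ^ ρ * 1)) = 1 := by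
    have e : σ (ϖ ^ ρ) * D₁ * ϖ ^ ρ + σ (ϖ ^ ρ * 1) * D₂ * (ϖ ^ ρ * 1) = σ (ϖ ^ ρ) * ϖ ^ ρ * D₁ * (g * (1 + g)⁻¹) := by
      rw [mul_one, hD₂]; field_simp; ring
    rw [e, map_mul, map_mul, map_mul, hvσϖρ, hvϖρ, hvD₁, map_mul, map_inv₀, h1g, hg, inv_one, mul_one, ← pow_add,
      show ρ + ρ = 2 * ρ by ring]
    have e2 : Valued.v ϖ ^ c = Valued.v ϖ ^ (2 * ρ) * Valued.v ϖ ^ (2 * t) := by rw [← pow_add]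
    rw [e2, mul_inv]
    have h2ρ : Valued.v ϖ ^ (2 * ρ) ≠ 0 := pow_ne_zero _ hvϖ.ne'
    have h2t : Valued.v ϖ ^ (2 * t) ≠ 0 := pow_ne_zero _ hvϖ.ne'
    calc Valued.v ϖ ^ (2 * ρ) * ((Valued.v ϖ ^ (2 * ρ))⁻¹ * (Valued.v ϖ ^ (2 * t))⁻¹) * Valued.v ϖ ^ (2 * t)
        = (Valued.v ϖ ^ (2 * ρ) * (Valued.v ϖ ^ (2 * ρ))⁻¹) * ((Valued.v ϖ ^ (2 * t))⁻¹ * Valued.v ϖ ^ (2 * t)) := by ac_rfl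
      _ = 1 := by rw [mul_inv_cancel₀ h2ρ, inv_mul_cancel₀ h2t, one_mul]
  have hGint : IsIntMatrix (formCongr σ V (Matrix.diagonal D)) := by
    rw [hG]
    refine isIntMatrix_of_fin_three ?_ ?_ ?_ ?_ ?_ ?_ ?_ ?_ ?_
    · rw [hG00, map_zero]; exact zero_le
    · rw [hG01, map_zero]; exact zero_le
    · exact hG02.le
    · rw [hG10, map_zero]; exact zero_le
    · exact hG11.le
    · rw [mul_one, map_mul, map_mul, hvσϖρ, hvD₂, hvϖcK, mul_assoc, inv_mul_cancel₀ hvϖc, mul_one]; exact hpowle ρ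
    · exact hG20.le
    · rw [mul_one, map_mul, map_mul, hvσϖcK, hvD₂, mul_inv_cancel₀ hvϖc, one_mul, hvϖρ]; exact hpowle ρ
    · rw [map_mul, map_mul, hvσϖcK, hvD₂, mul_inv_cancel₀ hvϖc, one_mul, hvϖcK]; exact hpowle c
  -- the determinant
  have hdet : Valued.v (formCongr σ V (Matrix.diagonal D)).det = 1 := by
    rw [det_formCongr_diagonal, det_coe_hnf 1 (1 * 1 + g) (ϖ ^ ρ * 1) (ϖ ^ ρ) (ϖ ^ c) V (by rw [hV]), hD0, hD1, hD2]
    simp only [map_mul, map_pow, hvσ, hvD₀, hvD₁, hvD₂]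
    set A := Valued.v ϖ ^ ρ with hA
    set C := Valued.v ϖ ^ c with hC
    set B := Valued.v ϖ ^ (2 * t) with hB
    have hA0 : A ≠ 0 := pow_ne_zero _ hvϖ.ne'
    have hC0 : C ≠ 0 := hvϖc
    have eC : C = A * A * B := by rw [hC, hA, hB, hc, ← pow_add, ← pow_add]; congr 1; ring
    rw [eC]
    have hB0 : B ≠ 0 := pow_ne_zero _ hvϖ.ne'
    field_simp
  have hinv : IsIntMatrix (ϖ • (formCongr σ V (Matrix.diagonal D))⁻¹) := fun i j => by
    rw [Matrix.smul_apply, smul_eq_mul, map_mul]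
    exact mul_le_one' hϖ1' (isIntMatrix_nonsing_inv_of_v_det_eq_one hGint hdet i j)
  exact (isVertexLattice_latt_iff_of_v σ hvσ hϖ0 (Matrix.diagonal D) 0 V).2 ⟨hGint, hinv, by rw [hdet, pow_zero]⟩


/-! ## §2  `kappaCount` is constant on `(K^×)³`-orbits -/

/-- The translate of the coset `D·S_F(M)` by a fixed vector `w` (slotwise `D ↦ D·w`) is the coset `(D·w)·S_F(M)`. [cite: Kottwitz1986BaseChangeUnits, §1 pp. 240–241] -/
theorem image_mul_coset_eq (σ : K →+* K) (M : Submodule 𝒪[K] (Fin 3 → K)) (D w : Fin 3 → K) :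
    (fun E : Fin 3 → K => fun j => E j * w j) '' {E : Fin 3 → K | ∃ u ∈ fixedUnitStabilizer σ M, ∀ j, E j = D j * ((u j : Kˣ) : K)} =
      {E : Fin 3 → K | ∃ u ∈ fixedUnitStabilizer σ M, ∀ j, E j = (D j * w j) * ((u j : Kˣ) : K)} := by
  ext E
  simp only [Set.mem_image, Set.mem_setOf_eq]
  constructor
  · rintro ⟨E', ⟨u, hu, hE'⟩, rfl⟩
    exact ⟨u, hu, fun j => by show E' j * w j = _; rw [hE' j]; ring⟩
  · rintro ⟨u, hu, hE⟩
    exact ⟨fun j => D j * ((u j : Kˣ) : K), ⟨u, hu, fun j => rfl⟩, funext fun j => by rw [hE j]; ring⟩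

/-- **THE POLARISATION COSETS OF `diag(z)·M` ARE THE `N(z)⁻¹`-TRANSLATES OF THOSE OF `M`** (`σ` an involution; any vertex type): `D′` polarises `diag(z)·M` iff `D′·N(z)` polarises `M`
(★ `isVertexLattice_diagonal_mapGL_diagGLUnits_iff`), and `S_F(diag(z)·M) = S_F(M)` (★ `fixedUnitStabilizer_mapGL_diagGLUnits`). [cite: Kottwitz1986BaseChangeUnits, §1 pp. 240–241] -/
theorem polarisationCosets_mapGL_diagGLUnits {σ : K →+* K} (hσ : ∀ a, σ (σ a) = a) (ϖ : K) (tv : ℕ) (z : Fin 3 → Kˣ) (M : Submodule 𝒪[K] (Fin 3 → K)) :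
    polarisationCosets σ ϖ tv (mapGL (diagGLUnits z) M) =
      (fun C : Set (Fin 3 → K) => (fun E : Fin 3 → K => fun j => E j * (((z j : K))⁻¹ * σ ((z j : K))⁻¹)) '' C) '' polarisationCosets σ ϖ tv M := by
  have hz : ∀ j, ((z j : Kˣ) : K) ≠ 0 := fun j => (z j).ne_zero
  have hN : ∀ j, ((z j : K) * σ (z j)) * (((z j : K))⁻¹ * σ ((z j : K))⁻¹) = 1 := fun j => by
    rw [map_inv₀]; field_simp
  have hσN : ∀ j, σ (((z j : K))⁻¹ * σ ((z j : K))⁻¹) = ((z j : K))⁻¹ * σ ((z j : K))⁻¹ := fun j => by rw [map_mul, hσ, mul_comm]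
  have hN0 : ∀ j, ((z j : K))⁻¹ * σ ((z j : K))⁻¹ ≠ 0 := fun j =>
    mul_ne_zero (inv_ne_zero (hz j)) ((map_ne_zero σ).2 (inv_ne_zero (hz j)))
  rw [polarisationCosets, polarisationCosets, fixedUnitStabilizer_mapGL_diagGLUnits]
  ext C'
  simp only [Set.mem_setOf_eq, Set.mem_image]
  constructor
  · rintro ⟨D', ⟨hD', hV'⟩, rfl⟩
    -- `D := D′·N(z)` polarises `M`
    refine ⟨{E | ∃ u ∈ fixedUnitStabilizer σ M, ∀ j, E j = (D' j * ((z j : K) * σ (z j))) * ((u j : Kˣ) : K)},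
      ⟨fun j => D' j * ((z j : K) * σ (z j)), ⟨fun j => ⟨?_, ?_⟩, (isVertexLattice_diagonal_mapGL_diagGLUnits_iff σ ϖ D' z tv M).1 hV'⟩, rfl⟩, ?_⟩
    · rw [map_mul, (hD' j).1, map_mul, hσ, mul_comm (σ (z j : K))]
    · exact mul_ne_zero (hD' j).2 (mul_ne_zero (hz j) ((map_ne_zero σ).2 (hz j)))
    · rw [image_mul_coset_eq]
      ext E
      simp only [Set.mem_setOf_eq]
      refine exists_congr fun u => and_congr_right fun _ => forall_congr' fun j => ?_
      rw [mul_assoc (D' j), hN j, mul_one]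
  · rintro ⟨C, ⟨D, ⟨hD, hV⟩, rfl⟩, rfl⟩
    refine ⟨fun j => D j * (((z j : K))⁻¹ * σ ((z j : K))⁻¹), ⟨fun j => ⟨?_, ?_⟩, ?_⟩, ?_⟩
    · rw [map_mul, (hD j).1, hσN j]
    · exact mul_ne_zero (hD j).2 (hN0 j)
    · have e : (fun i => D i * (((z i : K))⁻¹ * σ ((z i : K))⁻¹) * ((z i : K) * σ (z i))) = D :=
        funext fun j => by rw [mul_assoc, mul_comm (((z j : K))⁻¹ * σ ((z j : K))⁻¹), hN j, mul_one]
      have h := (isVertexLattice_diagonal_mapGL_diagGLUnits_iff σ ϖ (fun j => D j * (((z j : K))⁻¹ * σ ((z j : K))⁻¹)) z tv M).2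
      simp only [e] at h
      exact h hV
    · rw [image_mul_coset_eq]

omit [Valued K ℤᵐ⁰] in
open Classical in
/-- Translating a set of forms by norm factors does not change its κ-sign. [cite: LanglandsShelstad1987, §3] -/
theorem cosetKappa_image_mul_norm (σ : K →+* K) (i : Fin 3) (C : Set (Fin 3 → K)) (w : Fin 3 → K) (hw : ∀ j, w j ≠ 0) :
    cosetKappa σ i ((fun E : Fin 3 → K => fun j => E j * (w j * σ (w j))) '' C) = cosetKappa σ i C := by
  have hχ : ∀ E : Fin 3 → K, chiVec σ i (fun j => E j * (w j * σ (w j))) = chiVec σ i E := fun E => chiVec_mul_norm σ i E w hw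
  have hiff : ∀ a : ℤ, (∀ D ∈ (fun E : Fin 3 → K => fun j => E j * (w j * σ (w j))) '' C, chiVec σ i D = a) ↔ ∀ D ∈ C, chiVec σ i D = a := by
    intro a
    constructor
    · intro h D hD
      rw [← hχ D]
      exact h _ ⟨D, hD, rfl⟩
    · rintro h _ ⟨D, hD, rfl⟩
      rw [hχ D]
      exact h D hD
  rw [cosetKappa_eq, cosetKappa_eq]
  exact if_congr (hiff 1) rfl (if_congr (hiff (-1)) rfl rfl)

/-- **`kappaCount σ ϖ tv i` IS CONSTANT ON `(K^×)³`-ORBITS** (`σ` an involution): `kappaCount (diag(z)·M) = kappaCount M`.  (So the κ-weighted census over a unit-torus orbit is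
`κ(M₀) · Σ_{orbit} w`.) [cite: Kottwitz1986BaseChangeUnits, §1 pp. 240–241] [cite: LanglandsShelstad1987, §3] -/
theorem kappaCount_mapGL_diagGLUnits {σ : K →+* K} (hσ : ∀ a, σ (σ a) = a) (ϖ : K) (tv : ℕ) (i : Fin 3) (z : Fin 3 → Kˣ)
    (M : Submodule 𝒪[K] (Fin 3 → K)) :
    kappaCount σ ϖ tv i (mapGL (diagGLUnits z) M) = kappaCount σ ϖ tv i M := by
  have hz : ∀ j, ((z j : K))⁻¹ ≠ 0 := fun j => inv_ne_zero (z j).ne_zero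
  set τ : (Fin 3 → K) → (Fin 3 → K) := fun E j => E j * (((z j : K))⁻¹ * σ ((z j : K))⁻¹) with hτ
  have hτinj : Function.Injective τ := by
    intro E E' h
    funext j
    have hj := congrFun h j
    simp only [hτ] at hj
    exact mul_right_cancel₀ (mul_ne_zero (hz j) ((map_ne_zero σ).2 (hz j))) hj
  have himg : Function.Injective (Set.image τ) := Set.image_injective.2 hτinj
  rw [kappaCount_eq, kappaCount_eq, polarisationCosets_mapGL_diagGLUnits hσ ϖ tv z M, finsum_mem_image himg.injOn]
  exact finsum_mem_congr rfl fun C _ => cosetKappa_image_mul_norm σ i C (fun j => ((z j : K))⁻¹) hz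

/-! ## §3  `χ_i` of the explicit polarisation -/

omit [Valued K ℤᵐ⁰] in
/-- **`χ_i` OF THE EXPLICIT POLARISATION `D(g) = D₁·(g, 1, −(1+g)⁻¹)`, `D₁ = π₀^{−(ρ+t)}`** (under NI2 with a non-norm witness `c`; `g`, `1+g` fixed and non-zero):
`χ_0 = ω(−1)ω(1+g)`, `χ_1 = ω(−1)ω(g)ω(1+g)`, `χ_2 = ω(g)` (`ω(D₁) = 1` as `D₁ = N((ϖ^{ρ+t})⁻¹)`, `ω(x⁻¹) = ω(x)`). [cite: LanglandsShelstad1987, §3] [cite: Rogawski1990, §4.9 p. 55] -/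
theorem chiVec_glued_rep (σ : K →+* K) (hσ : ∀ a, σ (σ a) = a) {c : K} (hσc : σ c = c) (hc : ¬ ∃ z : K, z * σ z = c)
    (hdich : ∀ s : K, σ s = s → s ≠ 0 → (∃ z : K, z * σ z = s) ∨ ∃ z : K, z * σ z = c * s)
    {ϖ : K} (hϖ0 : ϖ ≠ 0) (ρ t : ℕ) {g : K} (hσg : σ g = g) (hg0 : g ≠ 0) (h1g0 : 1 + g ≠ 0) (i : Fin 3) :
    chiVec σ i ![((ϖ * σ ϖ) ^ (ρ + t))⁻¹ * g, ((ϖ * σ ϖ) ^ (ρ + t))⁻¹, -(((ϖ * σ ϖ) ^ (ρ + t))⁻¹ * (1 + g)⁻¹)] =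
      (![normSign σ (-1) * normSign σ (1 + g), normSign σ (-1) * normSign σ g * normSign σ (1 + g), normSign σ g] : Fin 3 → ℤ) i := by
  set D₁ : K := ((ϖ * σ ϖ) ^ (ρ + t))⁻¹ with hD₁
  have hσϖ0 : σ ϖ ≠ 0 := fun h => hϖ0 (by rw [← hσ ϖ, h, map_zero])
  have hD₁N : D₁ = (ϖ ^ (ρ + t))⁻¹ * σ ((ϖ ^ (ρ + t))⁻¹) := by rw [hD₁, map_inv₀, map_pow, mul_pow, mul_inv]
  have hD₁0 : D₁ ≠ 0 := by rw [hD₁]; exact inv_ne_zero (pow_ne_zero _ (mul_ne_zero hϖ0 hσϖ0))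
  have hσD₁ : σ D₁ = D₁ := by rw [hD₁, map_inv₀, map_pow, map_mul, hσ, mul_comm (σ ϖ)]
  have hωD₁ : normSign σ D₁ = 1 := normSign_of_isNorm σ ⟨(ϖ ^ (ρ + t))⁻¹, hD₁N.symm⟩
  have hσ1g : σ (1 + g) = 1 + g := by rw [map_add, map_one, hσg]
  have hσn1 : σ (-1 : K) = -1 := by rw [map_neg, map_one]
  have hω0 : normSign σ (D₁ * g) = normSign σ g := by
    rw [normSign_mul_of_dichotomy σ hσc hc hdich hσD₁ hσg hD₁0 hg0, hωD₁, one_mul]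
  have hω2 : normSign σ (-(D₁ * (1 + g)⁻¹)) = normSign σ (-1) * normSign σ (1 + g) := by
    rw [neg_eq_neg_one_mul, normSign_mul_of_dichotomy σ hσc hc hdich hσn1 (by rw [map_mul, hσD₁, map_inv₀, hσ1g]) (by norm_num)
      (mul_ne_zero hD₁0 (inv_ne_zero h1g0)), normSign_mul_of_dichotomy σ hσc hc hdich hσD₁ (by rw [map_inv₀, hσ1g]) hD₁0 (inv_ne_zero h1g0),
      hωD₁, one_mul, normSign_inv_of_map_eq σ hσ1g h1g0]
  rw [chiVec_eq]
  fin_cases i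
  · simp [hωD₁, hω2]
  · simp only [Fin.mk_one, Fin.isValue, Matrix.cons_val_one, Matrix.cons_val_zero, Matrix.cons_val_two, Matrix.head_cons, Matrix.tail_cons, hω0, hω2]
    ring
  · simp [hω0, hωD₁]


end Summit.HodgeConjecture.HodgeConjecture.Cruxes.H413.F0P3cDyRamDiagonalKappaGluedClassForm

end
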